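import Mathlib
import HarnessLib
import Summits.ABC.ABC.Theses.ParitySliceConcordantNorms

/-!
# Line `birth` — BC3 skeleton for the crux `NonSquareTopABC` (stmt-ABC-4010)

Route `ParitySliceConcordantNorms` (route-ABC-parity-slice-concordant-norms), crux
`NonSquareTopABC := ∀ ε > 0, ∃ C > 0, ∀ abc-triples (a,b,c) with c NOT a perfect square, c < C · rad(abc)^(1+ε)`.

THE LINE = the route's own two-layer plan for its target, typed as a REGIME SPLIT BY SLICE SIGNATURE.
Every abc triple lies in exactly one parity slice `σ = (a₀,b₀,c₀)`: `a = a₀x², b = b₀y², c = c₀z²` with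
`a₀b₀c₀` squarefree (squarefree parts; pairwise coprime because `a,b,c` are), and `c` is a non-square
iff `c₀ > 1` (proved below, `slice_of_triple` / `not_isSquare_of_slice`). Split the slices with `c₀ > 1` by the
size of the signature `|σ| := a₀b₀c₀`:

* `stub_genericSliceLangevin` — abc INSIDE EACH slice with `c₀ > 1`, constant `C(σ,ε)` allowed to depend on the
  slice: VERBATIM the route's rank-2 crux `GenericSliceLangevin` (stmt-ABC-4011; Langevin's bound for ONE conic sextic
  `F_σ` with `S₆(ℚ) = ∅`, the breeding-immune core). It pays for any FINITE set of slices.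
* `stub_largeSliceUniform` — abc UNIFORMLY over all slices of large signature: for every `ε > 0` there are `N(ε)` and
  `C(ε) > 0` such that the inequality holds on every slice with `c₀ > 1` and `a₀b₀c₀ > N(ε)`. This is the standalone
  content of the route's rank-3 crux `SliceUniformity` (`GenericSliceLangevin → NonSquareTopABC`): given stub 1,
  `stub_largeSliceUniform ↔ NonSquareTopABC` (both directions proved here), i.e. it is exactly what uniformity of the
  constants `C(σ,ε)` in `|σ|` must deliver beyond any bounded family of slices.
* `NonSquareTopABC_of : stub₁-sig → stub₂-sig → NonSquareTopABC` — REAL proof (≈ 60 lines, no sorry): decompose the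
  triple into its slice; if `a₀b₀c₀ > N(ε)` use stub 2; otherwise `σ ∈ [0,N]³`, finitely many slices, and the sum of
  their stub-1 constants is a uniform constant.
* `stubs_of_crux`, `crux_iff_stubs` — sorry-free: both stubs follow from the crux (restriction), so the split is EXACT
  (`NonSquareTopABC ↔ stub₁-sig ∧ stub₂-sig`) and neither stub is refutable short of `¬NonSquareTopABC` (≡ `¬ABC`,
  the crux being ABC-complete by the route's Assembly).

`sorry` occurs ONLY in the two `stub_*` theorems.
-/

-- `Summit.<Summit>.<Problem>`: for the single-conjunct summit `ABC` the duplicate `ABC.ABC` is mandated.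
set_option linter.dupNamespace false

namespace Summit.ABC.ABC.Cruxes.NonSquareTopABC.Birth

open Literature.NumberTheory.DiophantineGeometry
open Summit.ABC.ABC.Theses.ParitySliceConcordantNorms

/-! ## The two registered OPEN stubs -/

/-- **Stub 1 (bounded-signature regime = the route's rank-2 crux `GenericSliceLangevin`, stmt-ABC-4011, verbatim).**
Per-slice abc: for each parity slice `σ = (a₀,b₀,c₀)` (`a₀b₀c₀` squarefree, `c₀ > 1`) and `ε > 0` a constant
`C(σ,ε) > 0` with `c₀z² < C · rad^(1+ε)` for all abc triples `(a₀x², b₀y², c₀z²)`. Strictly weaker than the crux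
(no uniformity in `σ`); open already for `σ = (1,2,3)`. Implied by the crux (`stubs_of_crux`).
Sources: BombieriGubler2006 (Thm 12.2.12, Lemma 12.2.11), Langevin1993, Stewart2013. -/
theorem stub_genericSliceLangevin :
    ∀ a₀ b₀ c₀ : ℕ, Squarefree (a₀ * b₀ * c₀) → 1 < c₀ → ∀ ε : ℝ, 0 < ε → ∃ C : ℝ, 0 < C ∧
      ∀ x y z : ℕ, IsABCTriple (a₀ * x ^ 2) (b₀ * y ^ 2) (c₀ * z ^ 2) →
        ((c₀ * z ^ 2 : ℕ) : ℝ) <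
          C * ((rad (a₀ * x ^ 2) (b₀ * y ^ 2) (c₀ * z ^ 2) : ℕ) : ℝ) ^ (1 + ε) := by
  sorry

/-- **Stub 2 (large-signature regime: uniform abc over slices of large signature).**
For every `ε > 0` there are a threshold `N` and ONE constant `C > 0` such that `c₀z² < C · rad^(1+ε)` for every
abc triple `(a₀x², b₀y², c₀z²)` in every slice with `a₀b₀c₀` squarefree, `c₀ > 1` and `a₀b₀c₀ > N`.
The standalone content of the route's rank-3 crux `SliceUniformity`: modulo stub 1 it is equivalent to the crux
(`crux_iff_stubs`); alone it misses the finitely many slices of signature `≤ N(ε)`, each an open Langevin problem.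
Why it might fail: every known per-form bound carries the height of `F_σ` (regulator of `ℚ(√−a₀b₀, √a₀c₀)`
`≍ |σ|^(1/2+o(1))`) in the exponent; a `|σ|^κ` loss only gives `c ≪ rad^(1+ε+κ)`. Implied by the crux.
Sources: EvertseGyory2015 (§4), BombieriGubler2006 (Lemma 12.2.11), Gyory2008. -/
theorem stub_largeSliceUniform :
    ∀ ε : ℝ, 0 < ε → ∃ N : ℕ, ∃ C : ℝ, 0 < C ∧
      ∀ a₀ b₀ c₀ x y z : ℕ, Squarefree (a₀ * b₀ * c₀) → 1 < c₀ → N < a₀ * b₀ * c₀ →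
        IsABCTriple (a₀ * x ^ 2) (b₀ * y ^ 2) (c₀ * z ^ 2) →
          ((c₀ * z ^ 2 : ℕ) : ℝ) <
            C * ((rad (a₀ * x ^ 2) (b₀ * y ^ 2) (c₀ * z ^ 2) : ℕ) : ℝ) ^ (1 + ε) := by
  sorry

/-! ## Slice coordinates (sorry-free glue) -/

/-- Every abc triple with non-square top lies in a parity slice `(a₀,b₀,c₀)` with `a₀b₀c₀` squarefree and
`c₀ > 1`. [folklore] -/
theorem slice_of_triple (a b c : ℕ) (ht : IsABCTriple a b c) (hns : ¬ IsSquare c) :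
    ∃ a₀ b₀ c₀ x y z : ℕ, Squarefree (a₀ * b₀ * c₀) ∧ 1 < c₀ ∧
      a = a₀ * x ^ 2 ∧ b = b₀ * y ^ 2 ∧ c = c₀ * z ^ 2 := by
  obtain ⟨ha, hb, habc, hcop⟩ := ht
  have hc : 0 < c := by omega
  have hac : Nat.Coprime a c := by rw [← habc]; exact Nat.coprime_self_add_right.mpr hcop
  have hbc : Nat.Coprime b c := by rw [← habc]; exact Nat.coprime_add_self_right.mpr hcop.symm
  obtain ⟨a₀, x, ha₀, hx, hxa, hsa⟩ := Nat.sq_mul_squarefree_of_pos ha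
  obtain ⟨b₀, y, hb₀, hy, hyb, hsb⟩ := Nat.sq_mul_squarefree_of_pos hb
  obtain ⟨c₀, z, hc₀, hz, hzc, hsc⟩ := Nat.sq_mul_squarefree_of_pos hc
  have hda : a₀ ∣ a := ⟨x ^ 2, by rw [← hxa, mul_comm]⟩
  have hdb : b₀ ∣ b := ⟨y ^ 2, by rw [← hyb, mul_comm]⟩
  have hdc : c₀ ∣ c := ⟨z ^ 2, by rw [← hzc, mul_comm]⟩
  have hab₀ : Nat.Coprime a₀ b₀ :=
    Nat.Coprime.coprime_dvd_right hdb (Nat.Coprime.coprime_dvd_left hda hcop)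
  have hac₀ : Nat.Coprime a₀ c₀ :=
    Nat.Coprime.coprime_dvd_right hdc (Nat.Coprime.coprime_dvd_left hda hac)
  have hbc₀ : Nat.Coprime b₀ c₀ :=
    Nat.Coprime.coprime_dvd_right hdc (Nat.Coprime.coprime_dvd_left hdb hbc)
  have hsf : Squarefree (a₀ * b₀ * c₀) := by
    rw [Nat.squarefree_mul (Nat.Coprime.mul_left hac₀ hbc₀), Nat.squarefree_mul hab₀]
    exact ⟨⟨hsa, hsb⟩, hsc⟩
  have hc₀1 : c₀ ≠ 1 := by
    rintro rfl
    exact hns ⟨z, by rw [← hzc]; ring⟩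
  refine ⟨a₀, b₀, c₀, x, y, z, hsf, by omega, ?_, ?_, ?_⟩
  · rw [← hxa, mul_comm]
  · rw [← hyb, mul_comm]
  · rw [← hzc, mul_comm]

/-- A slice member `c₀ z²` with `c₀ > 1` squarefree (`z ≠ 0`) is not a perfect square: some prime has odd
exponent. [folklore] -/
theorem not_isSquare_mul_sq {c₀ z : ℕ} (hsf : Squarefree c₀) (hc₀ : 1 < c₀) (hz : z ≠ 0) :
    ¬ IsSquare (c₀ * z ^ 2) := by
  rintro ⟨r, hr⟩
  have hc0 : c₀ ≠ 0 := by omega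
  obtain ⟨p, hp, hpc⟩ := Nat.exists_prime_and_dvd hc₀.ne'
  have hr0 : r ≠ 0 := by
    rintro rfl
    simp at hr
    omega
  have h1 : c₀.factorization p = 1 := by
    have hle := (Nat.squarefree_iff_factorization_le_one hc0).mp hsf p
    have hpos := hp.factorization_pos_of_dvd hc0 hpc
    omega
  have key := congrArg (fun n => n.factorization p) hr
  simp only [Nat.factorization_mul hc0 (pow_ne_zero 2 hz), Nat.factorization_pow,
    Nat.factorization_mul hr0 hr0, Finsupp.add_apply, Finsupp.smul_apply, smul_eq_mul] at key
  omega

/-- In a slice with `a₀b₀c₀` squarefree and `c₀ > 1`, the top `c₀ z²` of an abc triple is not a square. [folklore] -/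
theorem not_isSquare_of_slice {a₀ b₀ c₀ x y z : ℕ} (hsf : Squarefree (a₀ * b₀ * c₀)) (hc₀ : 1 < c₀)
    (ht : IsABCTriple (a₀ * x ^ 2) (b₀ * y ^ 2) (c₀ * z ^ 2)) : ¬ IsSquare (c₀ * z ^ 2) := by
  have hsc : Squarefree c₀ := Squarefree.of_mul_right hsf
  have hz : z ≠ 0 := by
    rintro rfl
    obtain ⟨ha, hb, habc, -⟩ := ht
    rw [show c₀ * 0 ^ 2 = 0 by ring] at habc
    omega
  exact not_isSquare_mul_sq hsc hc₀ hz

/-- Signature bound: `a₀b₀c₀ ≤ N` with squarefree (hence non-zero) product puts `σ` in the box `[0,N]³`.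
[folklore] -/
theorem sig_le_of_prod_le {a₀ b₀ c₀ N : ℕ} (hsf : Squarefree (a₀ * b₀ * c₀)) (hN : a₀ * b₀ * c₀ ≤ N) :
    a₀ ≤ N ∧ b₀ ≤ N ∧ c₀ ≤ N := by
  have hpos : 0 < a₀ * b₀ * c₀ := Nat.pos_of_ne_zero (Squarefree.ne_zero hsf)
  refine ⟨le_trans (Nat.le_of_dvd hpos ?_) hN, le_trans (Nat.le_of_dvd hpos ?_) hN,
    le_trans (Nat.le_of_dvd hpos ?_) hN⟩
  · exact dvd_mul_of_dvd_left (dvd_mul_right a₀ b₀) c₀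
  · exact dvd_mul_of_dvd_left (dvd_mul_left b₀ a₀) c₀
  · exact dvd_mul_left c₀ (a₀ * b₀)

/-! ## The composition: the two stubs prove the crux BY NAME -/

/-- **Composition (sorry-free).** Bounded-signature regime by stub 1 (finitely many slices, sum of their
constants), large-signature regime by stub 2. [folklore] -/
theorem nonSquareTopABC_of_stubSigs
    (h₁ : ∀ a₀ b₀ c₀ : ℕ, Squarefree (a₀ * b₀ * c₀) → 1 < c₀ → ∀ ε : ℝ, 0 < ε → ∃ C : ℝ, 0 < C ∧
      ∀ x y z : ℕ, IsABCTriple (a₀ * x ^ 2) (b₀ * y ^ 2) (c₀ * z ^ 2) →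
        ((c₀ * z ^ 2 : ℕ) : ℝ) <
          C * ((rad (a₀ * x ^ 2) (b₀ * y ^ 2) (c₀ * z ^ 2) : ℕ) : ℝ) ^ (1 + ε))
    (h₂ : ∀ ε : ℝ, 0 < ε → ∃ N : ℕ, ∃ C : ℝ, 0 < C ∧
      ∀ a₀ b₀ c₀ x y z : ℕ, Squarefree (a₀ * b₀ * c₀) → 1 < c₀ → N < a₀ * b₀ * c₀ →
        IsABCTriple (a₀ * x ^ 2) (b₀ * y ^ 2) (c₀ * z ^ 2) →
          ((c₀ * z ^ 2 : ℕ) : ℝ) <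
            C * ((rad (a₀ * x ^ 2) (b₀ * y ^ 2) (c₀ * z ^ 2) : ℕ) : ℝ) ^ (1 + ε)) :
    NonSquareTopABC := by
  intro ε hε
  obtain ⟨N, C₂, hC₂, H₂⟩ := h₂ ε hε
  -- a TOTAL table of per-slice constants at this `ε` (junk value `1` off the admissible slices)
  have htab : ∀ a₀ b₀ c₀ : ℕ, ∃ C : ℝ, 0 < C ∧ (Squarefree (a₀ * b₀ * c₀) → 1 < c₀ →
      ∀ x y z : ℕ, IsABCTriple (a₀ * x ^ 2) (b₀ * y ^ 2) (c₀ * z ^ 2) →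
        ((c₀ * z ^ 2 : ℕ) : ℝ) <
          C * ((rad (a₀ * x ^ 2) (b₀ * y ^ 2) (c₀ * z ^ 2) : ℕ) : ℝ) ^ (1 + ε)) := by
    intro a₀ b₀ c₀
    by_cases h : Squarefree (a₀ * b₀ * c₀) ∧ 1 < c₀
    · obtain ⟨C, hC, H⟩ := h₁ a₀ b₀ c₀ h.1 h.2 ε hε
      exact ⟨C, hC, fun _ _ => H⟩
    · exact ⟨1, one_pos, fun hs hc => absurd ⟨hs, hc⟩ h⟩
  choose Cf hCfpos hCf using htab
  set S : Finset (ℕ × ℕ × ℕ) :=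
    Finset.range (N + 1) ×ˢ (Finset.range (N + 1) ×ˢ Finset.range (N + 1)) with hS
  set C₁ : ℝ := ∑ σ ∈ S, Cf σ.1 σ.2.1 σ.2.2 with hC₁
  have hC₁ : 0 ≤ C₁ := Finset.sum_nonneg fun σ _ => (hCfpos σ.1 σ.2.1 σ.2.2).le
  refine ⟨C₁ + C₂, by linarith, ?_⟩
  intro a b c ht hns
  obtain ⟨a₀, b₀, c₀, x, y, z, hsf, hc₀, rfl, rfl, rfl⟩ := slice_of_triple a b c ht hns
  have hR : (0 : ℝ) ≤ ((rad (a₀ * x ^ 2) (b₀ * y ^ 2) (c₀ * z ^ 2) : ℕ) : ℝ) ^ (1 + ε) :=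
    Real.rpow_nonneg (Nat.cast_nonneg _) _
  by_cases hN : N < a₀ * b₀ * c₀
  · -- large-signature regime: stub 2
    calc ((c₀ * z ^ 2 : ℕ) : ℝ)
        < C₂ * ((rad (a₀ * x ^ 2) (b₀ * y ^ 2) (c₀ * z ^ 2) : ℕ) : ℝ) ^ (1 + ε) :=
          H₂ a₀ b₀ c₀ x y z hsf hc₀ hN ht
      _ ≤ (C₁ + C₂) * ((rad (a₀ * x ^ 2) (b₀ * y ^ 2) (c₀ * z ^ 2) : ℕ) : ℝ) ^ (1 + ε) :=
          mul_le_mul_of_nonneg_right (by linarith) hR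
  · -- bounded-signature regime: one of the finitely many slices in the box `[0,N]³`, stub 1
    push Not at hN
    obtain ⟨ha₀, hb₀, hc₀N⟩ := sig_le_of_prod_le hsf hN
    have hmem : (a₀, b₀, c₀) ∈ S := by
      simp only [hS, Finset.mem_product, Finset.mem_range]
      omega
    have hle : Cf a₀ b₀ c₀ ≤ C₁ :=
      Finset.single_le_sum (f := fun σ : ℕ × ℕ × ℕ => Cf σ.1 σ.2.1 σ.2.2)
        (fun σ _ => (hCfpos σ.1 σ.2.1 σ.2.2).le) hmem
    calc ((c₀ * z ^ 2 : ℕ) : ℝ)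
        < Cf a₀ b₀ c₀ * ((rad (a₀ * x ^ 2) (b₀ * y ^ 2) (c₀ * z ^ 2) : ℕ) : ℝ) ^ (1 + ε) :=
          hCf a₀ b₀ c₀ hsf hc₀ x y z ht
      _ ≤ (C₁ + C₂) * ((rad (a₀ * x ^ 2) (b₀ * y ^ 2) (c₀ * z ^ 2) : ℕ) : ℝ) ^ (1 + ε) :=
          mul_le_mul_of_nonneg_right (by linarith) hR

/-- **THE SKELETON THEOREM.** The crux `Summit.ABC.ABC.Theses.ParitySliceConcordantNorms.NonSquareTopABC`,
concluded BY NAME from the two declared stubs. [folklore] -/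
theorem NonSquareTopABC_of :
    Summit.ABC.ABC.Theses.ParitySliceConcordantNorms.NonSquareTopABC :=
  nonSquareTopABC_of_stubSigs stub_genericSliceLangevin stub_largeSliceUniform

/-! ## Exactness and irrefutability of the stub set (sorry-free) -/

/-- Both stubs follow from the crux by restriction (so neither is refutable short of `¬NonSquareTopABC`).
[folklore] -/
theorem stubs_of_crux (h : NonSquareTopABC) :
    (∀ a₀ b₀ c₀ : ℕ, Squarefree (a₀ * b₀ * c₀) → 1 < c₀ → ∀ ε : ℝ, 0 < ε → ∃ C : ℝ, 0 < C ∧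
      ∀ x y z : ℕ, IsABCTriple (a₀ * x ^ 2) (b₀ * y ^ 2) (c₀ * z ^ 2) →
        ((c₀ * z ^ 2 : ℕ) : ℝ) <
          C * ((rad (a₀ * x ^ 2) (b₀ * y ^ 2) (c₀ * z ^ 2) : ℕ) : ℝ) ^ (1 + ε)) ∧
    (∀ ε : ℝ, 0 < ε → ∃ N : ℕ, ∃ C : ℝ, 0 < C ∧
      ∀ a₀ b₀ c₀ x y z : ℕ, Squarefree (a₀ * b₀ * c₀) → 1 < c₀ → N < a₀ * b₀ * c₀ →
        IsABCTriple (a₀ * x ^ 2) (b₀ * y ^ 2) (c₀ * z ^ 2) →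
          ((c₀ * z ^ 2 : ℕ) : ℝ) <
            C * ((rad (a₀ * x ^ 2) (b₀ * y ^ 2) (c₀ * z ^ 2) : ℕ) : ℝ) ^ (1 + ε)) := by
  refine ⟨fun a₀ b₀ c₀ hsf hc₀ ε hε => ?_, fun ε hε => ?_⟩
  · obtain ⟨C, hC, H⟩ := h ε hε
    exact ⟨C, hC, fun x y z ht => H _ _ _ ht (not_isSquare_of_slice hsf hc₀ ht)⟩
  · obtain ⟨C, hC, H⟩ := h ε hε
    exact ⟨0, C, hC, fun a₀ b₀ c₀ x y z hsf hc₀ _ ht => H _ _ _ ht (not_isSquare_of_slice hsf hc₀ ht)⟩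

/-- **Exactness.** The crux is EQUIVALENT to the conjunction of the two stub statements. [folklore] -/
theorem crux_iff_stubs :
    NonSquareTopABC ↔
    ((∀ a₀ b₀ c₀ : ℕ, Squarefree (a₀ * b₀ * c₀) → 1 < c₀ → ∀ ε : ℝ, 0 < ε → ∃ C : ℝ, 0 < C ∧
      ∀ x y z : ℕ, IsABCTriple (a₀ * x ^ 2) (b₀ * y ^ 2) (c₀ * z ^ 2) →
        ((c₀ * z ^ 2 : ℕ) : ℝ) <
          C * ((rad (a₀ * x ^ 2) (b₀ * y ^ 2) (c₀ * z ^ 2) : ℕ) : ℝ) ^ (1 + ε)) ∧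
    (∀ ε : ℝ, 0 < ε → ∃ N : ℕ, ∃ C : ℝ, 0 < C ∧
      ∀ a₀ b₀ c₀ x y z : ℕ, Squarefree (a₀ * b₀ * c₀) → 1 < c₀ → N < a₀ * b₀ * c₀ →
        IsABCTriple (a₀ * x ^ 2) (b₀ * y ^ 2) (c₀ * z ^ 2) →
          ((c₀ * z ^ 2 : ℕ) : ℝ) <
            C * ((rad (a₀ * x ^ 2) (b₀ * y ^ 2) (c₀ * z ^ 2) : ℕ) : ℝ) ^ (1 + ε))) :=
  ⟨stubs_of_crux, fun h => nonSquareTopABC_of_stubSigs h.1 h.2⟩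

/-- Both stubs are implied by `ABC` (restriction of the summit to non-square tops, then `stubs_of_crux`).
[folklore] -/
theorem stubs_of_abc (h : _root_.ABC) :
    (∀ a₀ b₀ c₀ : ℕ, Squarefree (a₀ * b₀ * c₀) → 1 < c₀ → ∀ ε : ℝ, 0 < ε → ∃ C : ℝ, 0 < C ∧
      ∀ x y z : ℕ, IsABCTriple (a₀ * x ^ 2) (b₀ * y ^ 2) (c₀ * z ^ 2) →
        ((c₀ * z ^ 2 : ℕ) : ℝ) <
          C * ((rad (a₀ * x ^ 2) (b₀ * y ^ 2) (c₀ * z ^ 2) : ℕ) : ℝ) ^ (1 + ε)) ∧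
    (∀ ε : ℝ, 0 < ε → ∃ N : ℕ, ∃ C : ℝ, 0 < C ∧
      ∀ a₀ b₀ c₀ x y z : ℕ, Squarefree (a₀ * b₀ * c₀) → 1 < c₀ → N < a₀ * b₀ * c₀ →
        IsABCTriple (a₀ * x ^ 2) (b₀ * y ^ 2) (c₀ * z ^ 2) →
          ((c₀ * z ^ 2 : ℕ) : ℝ) <
            C * ((rad (a₀ * x ^ 2) (b₀ * y ^ 2) (c₀ * z ^ 2) : ℕ) : ℝ) ^ (1 + ε)) :=
  stubs_of_crux fun ε hε => by
    obtain ⟨C, hC, H⟩ := h ε hε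
    exact ⟨C, hC, fun a b c ht _ => H a b c ht⟩

end Summit.ABC.ABC.Cruxes.NonSquareTopABC.Birth
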